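import Summits.BirchSwinnertonDyer.BirchSwinnertonDyer.Theorems.TwoAdicConverseOrdLambdaHalfAtTwoThetaDatumDefs
import Summits.BirchSwinnertonDyer.Rank1Residual.X2.DualRestrictionInvariants
import Literature.NumberTheory.EllipticCurves.IwasawaAlgebraSemilinearCharIdealProofs
import Literature.NumberTheory.EllipticCurves.IwasawaAlgebraDivisibilityProofs
import Literature.NumberTheory.EllipticCurves.IwasawaAlgebraProofs
import HarnessLib

/-!
# Route `TwoAdicConverse` (rung S3), crux `OrdLambdaHalfAtTwo` (item stmt-BirchSwinnertonDyer-19556), line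
# `kato-determinant-greenberg-two`, skeleton v4.5: the `μ`-invariant is BLIND to the keying automorphism `θ`
# (`μ`-transport along `θ`-semilinear bijections / injections for ANY ring automorphism `θ` of `Λ`), and the
# `μ`-Poitou–Tate bookkeeping of the re-keyed datum `ThetaShapiroKatoGreenbergDatum`

Seat `cruxlead-stmt-BirchSwinnertonDyer-19556-g4` (LEAD PROVER, MODE LINE; `--supports` stmt-BirchSwinnertonDyer-19556, helper).  HONEST FRAMING
(cell bsd-2adic): BSD is not proved by any of this; the crux is NOT proved here; THEOREMS ONLY (no definition, no named fact, no instance, no `sorry`).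
Pen ruling RC-373 (1)(ii) (2026-08-29): «λ AND μ of a torsion Λ-module are invariant under transport along ANY ring automorphism θ of Λ = ℤ₂⟦T⟧ … if
the μ-half of that sentence is not yet a tree lemma, it is the first --supports target of the next 19556 seat (one lemma
`muInvariant_eq_of_semilinear_bijective`), which also closes cdisprove's «θ-invariance of μ» junk-surface question for every (θ, θ_C)».

What is proved (the `λ`-half is `lambdaInvariant_eq_of_semilinear_bijective`, p686294):

* §1 (any prime `p`, Mathlib-style module theory over `Λ = ℤ_p⟦T⟧`).  A ring automorphism `θ : Λ ≃+* Λ` FIXES the point `(p)` of `Spec Λ`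
  (`θ p = p` for every ring homomorphism — no hypothesis `θ (C c) = C c` is needed for `μ`, contrary to `λ`):
  `comapEquiv_eq_self_of_asIdeal_eq_augIdealP`.  Hence, by the tree's transport of local lengths along semilinear equivalences
  (`Module.lengthAt_eq_of_semilinearEquiv`, Bourbaki AC VII §4.4), `lengthAt_eq_of_semilinear_ringEquiv_of_asIdeal_eq_augIdealP`,
  **`muInvariant_eq_of_semilinear_addEquiv`** / **`muInvariant_eq_of_semilinear_bijective`** (`μ(M) = μ(N)` along a bijective `θ`-semilinear map) and
  **`muInvariant_le_of_semilinear_injective`** (`μ(M) ≤ μ(N)` along an injective `θ`-semilinear map into a finitely generated torsion module: the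
  image is a `Λ`-submodule because `θ` is onto).
* §2 (the line's datum, `p = 2`).  For every `Sθ : ThetaShapiroKatoGreenbergDatum …`: `muInvariant_ker_eq` (`μ(ker π) = μ(𝐇¹_loc ⧸ L)` through the
  `θ`-semilinear bijection `δ : 𝐇¹_loc ⧸ L → ker π`), `mu_PT` (`μ(X_Gr) = μ(𝐇¹_loc ⧸ L) + μ(X_fine)` for `X_Gr` finitely generated torsion — `μ`-additivity
  along `ker π ↪ X_Gr ↠ X_fine`), `muInvariant_quotL_le` (`μ(𝐇¹_loc ⧸ L) ≤ μ(X_Gr)`), `muInvariant_fine_le` (`μ(X_fine) ≤ μ(X_Gr)`), and under the line's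
  B2 (`μ(X_Gr) = 0`, kernel modulo print): `muInvariant_quotL_eq_zero_of_mu_eq_zero`, `muInvariant_fine_eq_zero_of_mu_eq_zero`.  So the pair
  `(θ, θ_C)` of the v4.5 datum is NOT a junk surface for `μ`: whatever `θ`, any supply proof of 4‴ must exhibit a Shapiro lattice `L` with
  `μ(𝐇¹_loc ⧸ L) ≤ μ(X_Gr)` (`= 0`), exactly as for the `Λ`-linear v4.3 datum (cdisprove's `muInvariant_quotL_le_of_shapiroKatoGreenbergDatum`).

References: [Washington1997] §13.2 (the invariants `μ`, `λ`; the involution); [BourbakiAC5to7] Ch. VII §4.4 (local lengths, transport of structure);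
[GreenbergLNM1716] §1 p. 60 (the two `Λ`-structures on a Pontryagin dual); [Kato2004Asterisque] §17.13 (shape of the Poitou–Tate sequence only).
-/

set_option linter.dupNamespace false
set_option autoImplicit false

noncomputable section

open scoped Classical NumberField
open WeierstrassCurve NumberField IsDedekindDomain Field CategoryTheory Function
open Literature.NumberTheory.EllipticCurves Literature.NumberTheory.EllipticCurves.Rank1Residual
open Literature.NumberTheory.EllipticCurves.IwasawaAlgebra
open Literature.NumberTheory.EllipticCurves.Kato2004 Literature.NumberTheory.EllipticCurves.Kato2004.EulerSystemValues
open Literature.NumberTheory.GaloisRepresentations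
open Summit.BirchSwinnertonDyer.Rank1Residual.X1.MuLambda (lam)
open Summit.BirchSwinnertonDyer.Rank1Residual.X11b (AcSelmer.bdpData AcSelmer.strictDatum)

namespace Summit.BirchSwinnertonDyer.BirchSwinnertonDyer.Theorems.TwoAdicKatoDeterminant

/-! ## §1 `μ` is blind to the keying: transport along `θ`-semilinear maps for a ring automorphism `θ` of `Λ` -/

section MuTransport

variable {p : ℕ} [Fact p.Prime]
  {M : Type*} [AddCommGroup M] [Module (IwasawaAlgebra p) M]
  {N : Type*} [AddCommGroup N] [Module (IwasawaAlgebra p) N]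

/-- **A ring automorphism of `Λ = ℤ_p⟦T⟧` fixes the point `(p)` of `Spec Λ`**: `θ(p) = p` for every ring homomorphism, so the prime
`σ ↦ θ(σ)` (`PrimeSpectrum.comapEquiv θ`) is the identity at any `𝔓` with `𝔓.asIdeal = (p)`. [cite: Washington1997, §13.2] -/
theorem comapEquiv_eq_self_of_asIdeal_eq_augIdealP (θ : IwasawaAlgebra p ≃+* IwasawaAlgebra p)
    (𝔓 : PrimeSpectrum (IwasawaAlgebra p)) (h𝔓 : 𝔓.asIdeal = augIdealP p) :
    PrimeSpectrum.comapEquiv θ 𝔓 = 𝔓 := by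
  apply PrimeSpectrum.ext
  rw [PrimeSpectrum.comapEquiv_apply, PrimeSpectrum.comap_asIdeal, h𝔓]
  have hC : (PowerSeries.C (p : ℤ_[p]) : IwasawaAlgebra p) = (p : IwasawaAlgebra p) := map_natCast _ p
  unfold augIdealP
  rw [hC]
  ext f
  rw [Ideal.mem_comap, Ideal.mem_span_singleton, Ideal.mem_span_singleton]
  change (p : IwasawaAlgebra p) ∣ θ.symm f ↔ (p : IwasawaAlgebra p) ∣ f
  constructor
  · intro h
    have h' := map_dvd θ h
    rwa [map_natCast, RingEquiv.apply_symm_apply] at h'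
  · intro h
    have h' := map_dvd θ.symm h
    rwa [map_natCast] at h'

/-- **Local lengths at `(p)` are invariant under `θ`-semilinear additive equivalences**, `θ` any ring automorphism of `Λ`
(`Module.lengthAt_eq_of_semilinearEquiv` at the `θ`-fixed point `(p)`). [cite: BourbakiAC5to7, Ch. VII §4.4] [cite: Washington1997, §13.2] -/
theorem lengthAt_eq_of_semilinear_ringEquiv_of_asIdeal_eq_augIdealP (θ : IwasawaAlgebra p ≃+* IwasawaAlgebra p)
    (e : M ≃+ N) (he : ∀ (r : IwasawaAlgebra p) (m : M), e (r • m) = θ r • e m)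
    (𝔓 : PrimeSpectrum (IwasawaAlgebra p)) (h𝔓 : 𝔓.asIdeal = augIdealP p) :
    Module.lengthAt (IwasawaAlgebra p) M 𝔓 = Module.lengthAt (IwasawaAlgebra p) N 𝔓 := by
  rw [Module.lengthAt_eq_of_semilinearEquiv θ e he 𝔓, comapEquiv_eq_self_of_asIdeal_eq_augIdealP θ 𝔓 h𝔓]

/-- **`μ` is blind to the keying (additive-equivalence form)**: a `θ`-semilinear additive equivalence `e : M ≃+ N`, `θ` ANY ring
automorphism of `Λ = ℤ_p⟦T⟧`, preserves `muInvariant` (the sum of the local lengths at the points with ideal `(p)`, all `θ`-fixed).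
[cite: Washington1997, §13.2] [cite: GreenbergLNM1716, §1 p. 60 (the two Λ-structures on a dual)] -/
theorem muInvariant_eq_of_semilinear_addEquiv (θ : IwasawaAlgebra p ≃+* IwasawaAlgebra p)
    (e : M ≃+ N) (he : ∀ (r : IwasawaAlgebra p) (m : M), e (r • m) = θ r • e m) :
    muInvariant p M = muInvariant p N := by
  unfold muInvariant
  exact finsum_congr fun 𝔓 ↦ finsum_congr fun h𝔓 ↦ by
    rw [lengthAt_eq_of_semilinear_ringEquiv_of_asIdeal_eq_augIdealP θ e he 𝔓 h𝔓]

/-- **`μ` is blind to the keying**: a bijective `θ`-semilinear map between `Λ`-modules, `θ` ANY ring automorphism of `Λ = ℤ_p⟦T⟧`,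
preserves `muInvariant` (RC-373 (1)(ii); the `μ`-half of `lambdaInvariant_eq_of_semilinear_bijective` — for `μ` no hypothesis
`θ (C c) = C c` is needed, since every ring automorphism fixes `(p)`). [cite: Washington1997, §13.2]
[cite: GreenbergLNM1716, §1 p. 60 (the two Λ-structures on a dual)] -/
theorem muInvariant_eq_of_semilinear_bijective (θ : IwasawaAlgebra p ≃+* IwasawaAlgebra p)
    (f : M →ₛₗ[(θ : IwasawaAlgebra p →+* IwasawaAlgebra p)] N) (hf : Function.Bijective f) :
    muInvariant p M = muInvariant p N :=
  muInvariant_eq_of_semilinear_addEquiv θ (AddEquiv.ofBijective f.toAddMonoidHom hf) fun r m ↦ f.map_smulₛₗ r m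

/-- **`μ` is monotone along injective `θ`-semilinear maps into finitely generated torsion `Λ`-modules**, `θ` ANY ring automorphism of
`Λ`: `μ(M) = μ(f M) ≤ μ(N)` (the image is a `Λ`-submodule since `θ` is onto; `μ`-blindness of the keying; the local length at `(p)` is
monotone and finite on the target). [cite: Washington1997, §13.2] [cite: BourbakiAC5to7, Ch. VII §4.4] -/
theorem muInvariant_le_of_semilinear_injective [Module.Finite (IwasawaAlgebra p) N]
    (hN : Module.IsTorsion (IwasawaAlgebra p) N) (θ : IwasawaAlgebra p ≃+* IwasawaAlgebra p)
    (f : M →ₛₗ[(θ : IwasawaAlgebra p →+* IwasawaAlgebra p)] N) (hf : Function.Injective f) :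
    muInvariant p M ≤ muInvariant p N := by
  -- the image of `f` as a `Λ`-submodule of `N` (`c • f x = f (θ⁻¹ c • x)`, `θ` onto)
  let R : Submodule (IwasawaAlgebra p) N :=
    { carrier := Set.range f
      add_mem' := by
        rintro _ _ ⟨x, rfl⟩ ⟨y, rfl⟩
        exact ⟨x + y, f.map_add x y⟩
      zero_mem' := ⟨0, f.map_zero⟩
      smul_mem' := by
        rintro c _ ⟨x, rfl⟩
        refine ⟨θ.symm c • x, ?_⟩
        rw [f.map_smulₛₗ, RingHom.coe_coe, RingEquiv.apply_symm_apply] }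
  -- `M ≃+ R`, `θ`-semilinear
  let g : M →+ R := f.toAddMonoidHom.codRestrict R.toAddSubgroup fun x ↦ ⟨x, rfl⟩
  have hg : Function.Bijective g := by
    refine ⟨fun x y h ↦ hf (congrArg Subtype.val h), ?_⟩
    rintro ⟨_, x, rfl⟩
    exact ⟨x, rfl⟩
  have hμ : muInvariant p M = muInvariant p R :=
    muInvariant_eq_of_semilinear_addEquiv θ (AddEquiv.ofBijective g hg) fun r m ↦
      Subtype.ext (f.map_smulₛₗ r m)
  rw [hμ]
  let 𝔓 : PrimeSpectrum (IwasawaAlgebra p) := ⟨augIdealP p, isPrime_augIdealP_holds p⟩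
  rw [muInvariant_eq_toNat_lengthAt p R 𝔓 rfl, muInvariant_eq_toNat_lengthAt p N 𝔓 rfl]
  exact ENat.toNat_le_toNat (Module.lengthAt_submodule_le R 𝔓) (lengthAt_ne_top_of_isTorsion p N hN 𝔓 rfl)

end MuTransport

/-! ## §2 The `μ`-Poitou–Tate bookkeeping of the re-keyed datum (v4.5) -/

section ThetaMu

variable {W : WeierstrassCurve ℚ} [W.IsElliptic] [ContinuousSMul ℤ_[2] (W.tateModule 2)]
  {A : WeierstrassCurve ℚ} [A.IsElliptic] [ContinuousSMul ℤ_[2] (A.tateModule 2)]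
  {κ : ZpExtension ℚ 2} {γ : absoluteGaloisGroup ℚ}
  {I_W : IwasawaH1Data W 2 κ γ} {I_A : IwasawaH1Data A 2 κ γ}
  {v : HeightOneSpectrum (𝓞 ℚ)} {γᵥ : absoluteGaloisGroup (v.adicCompletion ℚ)}
  {J : LocalIwasawaH1Data κ v ((tateRep W 2).toLocal v) γᵥ}
  {J' : LocalIwasawaH1Data κ v (tateLocalOrdinaryRep W 2 v) γᵥ}
  {J_A : LocalIwasawaH1Data κ v ((tateRep A 2).toLocal v) γᵥ}
  {uA : ((tateRep A 2).toLocal v).toTopRep ⟶ ((tateRep W 2).toLocal v).toTopRep}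
  {hsurj : Function.Surjective
    (κ.toContinuousMonoidHom.comp (resGalOfEmb (closureEmb (K := ℚ) (v.adicCompletion ℚ))))}
  {hγ : κ.IsTopGenerator γ}
  {hγᵥ : κ.IsTopGenerator (resGalOfEmb (closureEmb (K := ℚ) (v.adicCompletion ℚ)) γᵥ)}
  {K : Type} [Field K] [NumberField K] {κK : ZpExtension K 2} {γK : absoluteGaloisGroup K}
  {w : HeightOneSpectrum (𝓞 K)}
  {DGr : (W.baseChange K).GreenbergStrictSelmerDualData κK γK (AcSelmer.bdpData (MK W K) 2 w)}
  {Dfi : (W.baseChange K).GreenbergStrictSelmerDualData κK γK (fineData W K)}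
  {L₀ L₀' : IwasawaAlgebra 2} {b b' : ℕ}

namespace ThetaShapiroKatoGreenbergDatum

variable (Sθ : ThetaShapiroKatoGreenbergDatum I_W I_A J J' J_A uA hsurj hγ hγᵥ DGr Dfi L₀ L₀' b b')

/-- **`μ(ker π) = μ(𝐇¹_loc ⧸ L)`**: exactness makes the `θ`-semilinear injection `δ` a bijection `𝐇¹_loc ⧸ L → ker π`, and `μ` is `θ`-blind
(`muInvariant_eq_of_semilinear_bijective`; the `μ`-twin of `lambdaInvariant_ker_eq`). [cite: GreenbergLNM1716, §1 p. 60] [cite: Washington1997, §13.2] -/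
theorem muInvariant_ker_eq : muInvariant 2 (LinearMap.ker Sθ.π) = muInvariant 2 (J.H ⧸ Sθ.L) := by
  have hmem : ∀ x, Sθ.δ x ∈ LinearMap.ker Sθ.π := fun x ↦ by
    rw [LinearMap.mem_ker]
    exact (Sθ.exact_δ_π (Sθ.δ x)).mpr ⟨x, rfl⟩
  let δ' : (J.H ⧸ Sθ.L) →ₛₗ[(Sθ.θ : IwasawaAlgebra 2 →+* IwasawaAlgebra 2)] LinearMap.ker Sθ.π :=
    { toFun := fun x ↦ ⟨Sθ.δ x, hmem x⟩
      map_add' := fun x y ↦ Subtype.ext (Sθ.δ.map_add x y)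
      map_smul' := fun a x ↦ Subtype.ext (Sθ.δ.map_smulₛₗ a x) }
  have hbij : Function.Bijective δ' := by
    refine ⟨fun x y h ↦ Sθ.δ_injective (congrArg Subtype.val h), fun ⟨z, hz⟩ ↦ ?_⟩
    obtain ⟨x, hx⟩ := (Sθ.exact_δ_π z).mp (LinearMap.mem_ker.mp hz)
    exact ⟨x, Subtype.ext hx⟩
  exact (muInvariant_eq_of_semilinear_bijective Sθ.θ δ' hbij).symm

/-- **`μ`-Poitou–Tate for the re-keyed datum**: with `X_Gr` finitely generated torsion, `μ(X_Gr) = μ(𝐇¹_loc ⧸ L) + μ(X_fine)` (`μ`-additivity along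
`ker π ↪ X_Gr ↠ X_fine`, tree `muInvariant_eq_add_of_surjective`, and `μ(ker π) = μ(𝐇¹_loc ⧸ L)`). [cite: Washington1997, §13.2]
[cite: GreenbergVatsal2000, §2] -/
theorem mu_PT (h : Module.Finite (IwasawaAlgebra 2) DGr.X ∧ Module.IsTorsion (IwasawaAlgebra 2) DGr.X) :
    muInvariant 2 DGr.X = muInvariant 2 (J.H ⧸ Sθ.L) + muInvariant 2 Dfi.X := by
  haveI := h.1
  rw [← Sθ.muInvariant_ker_eq]
  exact Summit.BirchSwinnertonDyer.Rank1Residual.X2.DualRestrictionInvariants.muInvariant_eq_add_of_surjective 2 Sθ.π h.2 Sθ.π_surjective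

/-- **`μ(𝐇¹_loc ⧸ L) ≤ μ(X_Gr)` for every re-keyed Shapiro-corrected Kato–Greenberg datum** with `X_Gr` finitely generated torsion — WHATEVER the keying
automorphism `θ` (the `θ`-semilinear typed field `δ : 𝐇¹_loc ⧸ L ↪ X_Gr` and `muInvariant_le_of_semilinear_injective`).  This is cdisprove's
`muInvariant_quotL_le_of_shapiroKatoGreenbergDatum` (v4.3, `Λ`-linear `δ`) for the v4.5 datum: the pair `(θ, θ_C)` opens no `μ`-junk surface.
[cite: Kato2004Asterisque, §17.13 (shape only)] [cite: Washington1997, §13.2] -/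
theorem muInvariant_quotL_le (hX : Module.Finite (IwasawaAlgebra 2) DGr.X) (hXt : Module.IsTorsion (IwasawaAlgebra 2) DGr.X) :
    muInvariant 2 (J.H ⧸ Sθ.L) ≤ muInvariant 2 DGr.X := by
  haveI := hX
  exact muInvariant_le_of_semilinear_injective hXt Sθ.θ Sθ.δ Sθ.δ_injective

include Sθ in
/-- `μ(X_fine) ≤ μ(X_Gr)` for every re-keyed datum with `X_Gr` finitely generated torsion (from `mu_PT`). [cite: Washington1997, §13.2] -/
theorem muInvariant_fine_le (hX : Module.Finite (IwasawaAlgebra 2) DGr.X) (hXt : Module.IsTorsion (IwasawaAlgebra 2) DGr.X) :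
    muInvariant 2 Dfi.X ≤ muInvariant 2 DGr.X := by
  rw [Sθ.mu_PT ⟨hX, hXt⟩]
  exact Nat.le_add_left _ _

/-- Under the line's B2 (`X_Gr` finitely generated torsion with `μ(X_Gr) = 0`, kernel modulo print since v3.3) every re-keyed datum has
`μ(𝐇¹_loc ⧸ L) = 0`: the Shapiro lattice of ANY supply proof of stub 4‴ is `μ`-free, whatever `θ`. [cite: Washington1997, §13.2] -/
theorem muInvariant_quotL_eq_zero_of_mu_eq_zero (hX : Module.Finite (IwasawaAlgebra 2) DGr.X)
    (hXt : Module.IsTorsion (IwasawaAlgebra 2) DGr.X) (hμ : muInvariant 2 DGr.X = 0) :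
    muInvariant 2 (J.H ⧸ Sθ.L) = 0 :=
  Nat.eq_zero_of_le_zero (hμ ▸ Sθ.muInvariant_quotL_le hX hXt)

include Sθ in
/-- Under the line's B2 every re-keyed datum has `μ(X_fine) = 0` (the fine dual over `K_∞` is `μ`-free). [cite: Washington1997, §13.2] -/
theorem muInvariant_fine_eq_zero_of_mu_eq_zero (hX : Module.Finite (IwasawaAlgebra 2) DGr.X)
    (hXt : Module.IsTorsion (IwasawaAlgebra 2) DGr.X) (hμ : muInvariant 2 DGr.X = 0) :
    muInvariant 2 Dfi.X = 0 :=
  Nat.eq_zero_of_le_zero (hμ ▸ Sθ.muInvariant_fine_le hX hXt)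

end ThetaShapiroKatoGreenbergDatum

/-- **No re-keyed datum under a `μ`-defect, for ANY keying**: if `X_Gr` is finitely generated torsion and EVERY sandwiched lattice `L`
(`range(loc_W ⊕ u_A loc_A) ≤ L`, `2·L ≤ range`) has `μ(X_Gr) < μ(𝐇¹_loc ⧸ L)`, the type `ThetaShapiroKatoGreenbergDatum …` is empty — the v4.5 form of
cdisprove's `isEmpty_shapiroKatoGreenbergDatum_of_forall_muInvariant_lt`; the keying `θ` gives no escape. [cite: Kato2004Asterisque, §17.13 (shape only)] -/
theorem isEmpty_thetaShapiroKatoGreenbergDatum_of_forall_muInvariant_lt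
    (hX : Module.Finite (IwasawaAlgebra 2) DGr.X) (hXt : Module.IsTorsion (IwasawaAlgebra 2) DGr.X)
    (hμ : ∀ L : Submodule (IwasawaAlgebra 2) J.H,
      LinearMap.range ((I_W.loc J hsurj hγ hγᵥ).coprod (J_A.map uA J ∘ₗ I_A.loc J_A hsurj hγ hγᵥ)) ≤ L →
      (∀ y ∈ L, (2 : IwasawaAlgebra 2) • y ∈
        LinearMap.range ((I_W.loc J hsurj hγ hγᵥ).coprod (J_A.map uA J ∘ₗ I_A.loc J_A hsurj hγ hγᵥ))) →
      muInvariant 2 DGr.X < muInvariant 2 (J.H ⧸ L)) :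
    IsEmpty (ThetaShapiroKatoGreenbergDatum I_W I_A J J' J_A uA hsurj hγ hγᵥ DGr Dfi L₀ L₀' b b') :=
  ⟨fun Sθ ↦ (not_lt.mpr (Sθ.muInvariant_quotL_le hX hXt)) (hμ Sθ.L Sθ.range_le Sθ.two_smul_mem)⟩

end ThetaMu

end Summit.BirchSwinnertonDyer.BirchSwinnertonDyer.Theorems.TwoAdicKatoDeterminant

end
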